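import Summits.QuantumFields.BalabanUV.Beta.D1BFx.GaugeSandwich

/-!
# `BalabanUV.Beta.D1BFx.GaugeSandwichLift` — road «BF-x», binder row D1, slot (K), debt X₁, brick **Q3c «GAUGE SANDWICH»**, PART 3 (THE LIFT FORM Q4 CONSUMES):
# on an5's cubic fine torus `Tor (fine (m+1) (cubic 4 p))`, for every torus vector field `g` and every `x ∈ ℤ⁴`,
# `(PcT (∂ᴴ g))(castT x) = Σ'_{q ∈ ℤ⁴} Pker m a x q · (∂ᴴ g)♯(q)` — «an5's `PcT` on a divergence IS the road's `ℤ⁴` projector `Pker` applied to the periodic lift»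

WHY.  The owner's Q4 coordination (journal 2026-08-20T19:25Z, «WHAT Q4 WILL CONSUME (ii)») asks for the gauge term ON LIFTS in exactly this shape, so that the
Tannery assembly runs on COLUMNS: PART 2 (`GaugeSandwich`, p233690) gives `PcT h = P̂_ℂ h` for `h ⊥ 1` (`PcT_GradOpH_eq_PhatC`); THIS FILE unfolds `P̂_ℂ h` at a
reduced point into the absolutely convergent `ℤ⁴` series `Σ'_q Pker x q · h(q̄)` (Q1's `sum_periodise₂_mul_of_rep` on the real and imaginary parts, owner's
`isPeriodic₂_Pker`∕`summable_abs_row_Pker`) and composes.  CONTENT: §1 `PhatC_mulVec_castT` (any complex torus function), **`PcT_GradOpH_castT_eq_tsum_Pker`**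
(the literal).  §2 (v1.1) THE CONSTANT MODE — X1-SPEC §0's audit item `R` («`range G′Q′* = range PcT ⊕ constants`») in kernel form: `Lhat_mulVec_const` (`L̂·1 = 0`),
`Shat_mulVec_const` (`Ŝ·1 = (m+1)⁴·1`), `AXhat_mulVec_one` (`ÂX·1 = a·1`), `Ghat_mulVec_one` (`Ĝ′·1 = a⁻¹·1`, periodised tower equation), **`Phat_mulVec_one`** (`P̂·1 = 1`:
the massive projector FIXES the constants, via the owner's `Phat_mul_Gshat`), `PhatC_mulVec_const`, `PcT_mulVec_const` (`PcT·1 = 0`, an5's `LapSinv_const`), and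
**`PcT_eq_PhatC_sub_const`**: `PcT v = P̂_ℂ v − (|T_η|⁻¹ Σ v)·1` for EVERY `v` — the two projectors differ EXACTLY by the orthogonal projector onto the constants.

HONEST FRAMING (cell contract, verbatim): «discharging `BetaPertH` makes Bałaban's UV stability UNCONDITIONAL — a real constructive-QFT
result; it is NOT the continuum limit and NOT the Clay problem.»  HONEST DEPENDENCY (verbatim): «continuum YM on T⁴ ⇐ BetaPertH ∧ nine
spine estimates (0/9 proved); BetaPertH ⇐ (D1) ∧ (D4) ∧ CAP+tail; G-an2-4 gates asym, D1 and NE2/3/4.»  [folklore] bookkeeping over landed modules, USED BY NAME;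
no `Prop` is minted, nothing is cited, no wall binder is instantiated; 0 sorry.  NOT D1, NOT BetaPertH, NOT summit progress.  ABSOLUTE RULE (cell, verbatim): «No
internally-minted statement may enter as a cited fact. Every hypothesis is either kernel-proved in this package or a verbatim quotation of a PUBLISHED theorem
with page reference. The manuscript(s) under audit are NOT citable for their own disputed steps — they are the thing under adjudication; programme-internal
(2001/route/tribunal) claims are never citable.»  Provenance: D1 formalisation swarm, unit `b2b-balaban-beta-d1-formalise-leaf-03` (gen 7), claim «X1-Q3c» part 3, 2026-08-20.
-/

noncomputable section

namespace Summit.QuantumFields.BalabanUV.Beta.D1BFx.GaugeSandwichLift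

open Finset Matrix
open scoped BigOperators Matrix ComplexConjugate
open Literature.MathematicalPhysics.QuantumFieldTheory.Balaban1983to89
open Literature.MathematicalPhysics.QuantumFieldTheory.Balaban1983to89.Beta
open B5Prop11Plancherel (Tor fine)
open B5Action121 (GradOp)
open B5Value126 (PcT PcT_mulVec)
open B5LaplaceInverse (LapSinv_const)
open B5Blocks16 (blockOf)
open AffineAveraging (dz codiff₁)
open VectorTails (castT)
open FreeLegDictionary (cubic)
open B6QGQLower276 (X)
open Summit.QuantumFields.BalabanUV.Beta.D1BFx.RProjector (Pker)
open Summit.QuantumFields.BalabanUV.Beta.D1BFx.PeriodisedKernels (isPeriodic₂_Pker summable_abs_row_Pker)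
open Summit.QuantumFields.BalabanUV.Beta.D1BFx.PeriodisedKernels (siteOf_valRep tblk)
open Summit.QuantumFields.BalabanUV.Beta.D1BFx.PeriodisedProjector (Phat Phat_apply Lhat Shat Ghat Gshat AXhat AXhat_eq Shat_mulVec_apply
  Gshat_eq Phat_mul_Gshat Ghat_mul_AXhat)
open Summit.QuantumFields.BalabanUV.Beta.D1BFx.StencilDictionaryTorus (liftT0)
open Summit.QuantumFields.BalabanUV.Beta.D1BFx.FibredPeriodisation (sum_periodise₂_mul_of_rep summable_row_mul_torusFun)
open Summit.QuantumFields.BalabanUV.Beta.D1BFx.GaugeSandwich (PhatC PhatC_eq map_ofReal_mulVec map_ofReal_mulVec_ofReal PcT_GradOpH_eq_PhatC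
  PcT_mulVec_eq_PhatC Lhat_mulVec_siteOf tblk_eq_iff_blockOf_eq sum_filter_blockOf)

variable (m : ℕ) {a : ℝ} (p : ℕ) [NeZero p]

/-- [folklore] **`P̂` ON A COMPLEX TORUS FUNCTION, UNFOLDED**: `(P̂ h)(x̄) = Σ'_{q ∈ ℤ⁴} Pker m a x q · h(q̄)` (absolutely convergent; `Pker` real,
jointly `(m+1)p`-periodic with summable rows — owner's `isPeriodic₂_Pker`∕`summable_abs_row_Pker`; Q1's unfold-and-regroup on `re h` and `im h`). -/
theorem PhatC_mulVec_castT (ha : 0 < a) (h : Tor (fine (m + 1) (cubic 4 p)) → ℂ) (x : X 4) :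
    (PhatC m a p *ᵥ h) (castT (fine (m + 1) (cubic 4 p)) x)
      = ∑' q : X 4, (Pker (d := 4) m a x q : ℂ) * h (castT (fine (m + 1) (cubic 4 p)) q) := by
  have hper := isPeriodic₂_Pker m ha (s := (m + 1) * p) ⟨p, rfl⟩
  have hrow := summable_abs_row_Pker m ha
  have hre := sum_periodise₂_mul_of_rep hper hrow (rfl : siteOf 4 ((m + 1) * p) x = siteOf 4 ((m + 1) * p) x) (fun z => (h z).re)
  have him := sum_periodise₂_mul_of_rep hper hrow (rfl : siteOf 4 ((m + 1) * p) x = siteOf 4 ((m + 1) * p) x) (fun z => (h z).im)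
  have hsR := summable_row_mul_torusFun (s := (m + 1) * p) (hrow x) (fun z => (h z).re)
  have hsI := summable_row_mul_torusFun (s := (m + 1) * p) (hrow x) (fun z => (h z).im)
  rw [PhatC_eq, map_ofReal_mulVec]
  simp only [Pi.add_apply, Pi.smul_apply, smul_eq_mul]
  have e1 : (Phat m a ((m + 1) * p) *ᵥ fun z => (h z).re) (castT (fine (m + 1) (cubic 4 p)) x)
      = ∑' q : X 4, Pker (d := 4) m a x q * (h (castT (fine (m + 1) (cubic 4 p)) q)).re := by
    simp only [Matrix.mulVec, dotProduct, Phat_apply]; exact hre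
  have e2 : (Phat m a ((m + 1) * p) *ᵥ fun z => (h z).im) (castT (fine (m + 1) (cubic 4 p)) x)
      = ∑' q : X 4, Pker (d := 4) m a x q * (h (castT (fine (m + 1) (cubic 4 p)) q)).im := by
    simp only [Matrix.mulVec, dotProduct, Phat_apply]; exact him
  rw [e1, e2, Complex.ofReal_tsum, Complex.ofReal_tsum, ← tsum_mul_left, ← Summable.tsum_add]
  · refine tsum_congr fun q => ?_
    set w := h (castT (fine (m + 1) (cubic 4 p)) q) with hw
    push_cast
    rw [← Complex.re_add_im w]
    simp only [Complex.add_re, Complex.ofReal_re, Complex.mul_re, Complex.I_re, Complex.ofReal_im, Complex.I_im,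
      Complex.add_im, Complex.mul_im]
    ring
  · exact (hsR.map Complex.ofRealHom Complex.continuous_ofReal).congr fun q => rfl
  · exact ((hsI.map Complex.ofRealHom Complex.continuous_ofReal).congr fun q => rfl).mul_left Complex.I

/-- [folklore] **THE GAUGE TERM ON LIFTS** (Q4's input (ii), the owner's literal): for every torus vector field `g` and every `x ∈ ℤ⁴`,
`(PcT (∂ᴴ g))(castT x) = Σ'_{q ∈ ℤ⁴} Pker m a x q · (∂ᴴ g)♯(q)`, `(∂ᴴ g)♯ := liftT0 (∂ᴴ g)`. -/
theorem PcT_GradOpH_castT_eq_tsum_Pker (ha : 0 < a) (g : Tor (fine (m + 1) (cubic 4 p)) × Fin 4 → ℂ) (x : X 4) :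
    (PcT (m + 1) (cubic 4 p) ((m + 1 : ℕ) : ℂ) *ᵥ ((GradOp (fine (m + 1) (cubic 4 p)) ((m + 1 : ℕ) : ℂ))ᴴ *ᵥ g))
        (castT (fine (m + 1) (cubic 4 p)) x)
      = ∑' q : X 4, (Pker (d := 4) m a x q : ℂ)
          * liftT0 (fine (m + 1) (cubic 4 p)) ((GradOp (fine (m + 1) (cubic 4 p)) ((m + 1 : ℕ) : ℂ))ᴴ *ᵥ g) q := by
  rw [PcT_GradOpH_eq_PhatC m p ha g, PhatC_mulVec_castT m p ha]
  rfl

/-! ## §2 The constant mode: `P̂` FIXES the constants, `PcT` KILLS them — `PcT = P̂ − Π_const` (X1-SPEC §0 audit item `R` in kernel form) -/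

section Const

variable (m : ℕ) {a : ℝ} (p : ℕ) [NeZero p]

/-- [folklore] `L̂·1 = 0`: the periodised Laplacian kills constants (`δd` of a constant lift vanishes). -/
theorem Lhat_mulVec_const (c : ℝ) : Lhat ((m + 1) * p) *ᵥ (fun _ => c) = 0 := by
  funext z
  rw [← siteOf_valRep (s := (m + 1) * p) z, Lhat_mulVec_siteOf, Pi.zero_apply]
  simp [codiff₁, dz]

/-- [folklore] `Ŝ·1 = (m+1)⁴·1`: a torus block has `(m+1)⁴` sites (owner's `Shat_mulVec_apply` + part 2's block dictionary + an5's `bpt` count). -/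
theorem Shat_mulVec_const (c : ℝ) :
    Shat m ((m + 1) * p) *ᵥ (fun _ => c) = fun _ => ((m : ℝ) + 1) ^ 4 * c := by
  funext z₀
  rw [Shat_mulVec_apply (m := m) rfl]
  have e : Finset.univ.filter (fun z => tblk m (s := (m + 1) * p) z = tblk m (s := (m + 1) * p) z₀)
      = Finset.univ.filter (fun z => blockOf (m + 1) (cubic 4 p) z = blockOf (m + 1) (cubic 4 p) z₀) := by
    ext z
    simp only [Finset.mem_filter, Finset.mem_univ, true_and, tblk_eq_iff_blockOf_eq]
  rw [e, sum_filter_blockOf, Finset.sum_const, Finset.card_univ, Fintype.card_pi, Fintype.card_fin, Finset.prod_const,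
    Finset.card_univ, Fintype.card_fin, nsmul_eq_mul]
  push_cast
  ring

/-- [folklore] `ÂX·1 = a·1` (owner's `AXhat_eq`: `(m+1)²·L̂ + (a∕(m+1)⁴)·Ŝ`). -/
theorem AXhat_mulVec_one (ha : 0 < a) : AXhat m a ((m + 1) * p) *ᵥ (fun _ => (1 : ℝ)) = fun _ => a := by
  rw [AXhat_eq, Matrix.add_mulVec, Matrix.smul_mulVec, Matrix.smul_mulVec, Lhat_mulVec_const, Shat_mulVec_const]
  funext z
  have hm : ((m : ℝ) + 1) ^ 4 ≠ 0 := by positivity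
  simp only [Pi.add_apply, Pi.smul_apply, Pi.zero_apply, smul_eq_mul, mul_one, smul_zero, zero_add]
  field_simp

/-- [folklore] `Ĝ′·1 = a⁻¹·1` (periodised tower equation `Ĝ′·ÂX = 1`). -/
theorem Ghat_mulVec_one (ha : 0 < a) : Ghat m a ((m + 1) * p) *ᵥ (fun _ => (1 : ℝ)) = fun _ => a⁻¹ := by
  have h1 := (Ghat_mul_AXhat (m := m) (a := a) ha (rfl : (m + 1) * p = (m + 1) * p)).1
  have h : Ghat m a ((m + 1) * p) *ᵥ (AXhat m a ((m + 1) * p) *ᵥ fun _ => (1 : ℝ)) = fun _ => 1 := by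
    rw [Matrix.mulVec_mulVec, h1, Matrix.one_mulVec]
  have e : (fun _ : Site 4 ((m + 1) * p) => a) = a • (fun _ : Site 4 ((m + 1) * p) => (1 : ℝ)) := by funext; simp
  rw [AXhat_mulVec_one m p ha, e, Matrix.mulVec_smul] at h
  funext z
  have hz := congrFun h z
  simp only [Pi.smul_apply, smul_eq_mul] at hz
  field_simp
  linarith [hz]

/-- [folklore] **`P̂·1 = 1`**: the periodised massive projector FIXES the constants (`1 = (a∕(m+1)⁴)·Ĝs·1 ∈ range Ĝs`, owner's `Phat_mul_Gshat`). -/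
theorem Phat_mulVec_one (ha : 0 < a) : Phat m a ((m + 1) * p) *ᵥ (fun _ => (1 : ℝ)) = fun _ => 1 := by
  have hG : Gshat m a ((m + 1) * p) *ᵥ (fun _ => (1 : ℝ)) = fun _ => ((m : ℝ) + 1) ^ 4 * a⁻¹ := by
    rw [Gshat_eq (m := m) ha rfl, ← Matrix.mulVec_mulVec, Shat_mulVec_const,
      show (fun _ : Site 4 ((m + 1) * p) => ((m : ℝ) + 1) ^ 4 * (1 : ℝ)) = (((m : ℝ) + 1) ^ 4) • (fun _ : Site 4 ((m + 1) * p) => (1 : ℝ)) by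
        funext; simp, Matrix.mulVec_smul, Ghat_mulVec_one m p ha]
    funext z; simp
  have hc : ((m : ℝ) + 1) ^ 4 * a⁻¹ ≠ 0 := by positivity
  have hP : Phat m a ((m + 1) * p) *ᵥ (Gshat m a ((m + 1) * p) *ᵥ fun _ => (1 : ℝ)) = Gshat m a ((m + 1) * p) *ᵥ fun _ => (1 : ℝ) := by
    rw [Matrix.mulVec_mulVec, Phat_mul_Gshat (m := m) ha rfl]
  rw [hG, show (fun _ : Site 4 ((m + 1) * p) => ((m : ℝ) + 1) ^ 4 * a⁻¹) = (((m : ℝ) + 1) ^ 4 * a⁻¹) • (fun _ : Site 4 ((m + 1) * p) => (1 : ℝ)) by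
    funext; simp, Matrix.mulVec_smul] at hP
  exact smul_right_injective (Site 4 ((m + 1) * p) → ℝ) hc hP

/-- [folklore] `P̂_ℂ` fixes every constant complex torus function. -/
theorem PhatC_mulVec_const (ha : 0 < a) (c : ℂ) :
    PhatC m a p *ᵥ (fun _ => c) = fun _ => c := by
  have e : (fun _ : Tor (fine (m + 1) (cubic 4 p)) => c) = c • (fun z : Site 4 ((m + 1) * p) => (((fun _ => (1 : ℝ)) z : ℝ) : ℂ)) := by
    funext; simp
  rw [e, Matrix.mulVec_smul, PhatC_eq, map_ofReal_mulVec_ofReal, Phat_mulVec_one m p ha]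

/-- [folklore] an5's `PcT` KILLS the constants (`LapSinv·const = 0`). -/
theorem PcT_mulVec_const (c : ℂ) : PcT (m + 1) (cubic 4 p) ((m + 1 : ℕ) : ℂ) *ᵥ (fun _ => c) = 0 := by
  rw [PcT_mulVec, LapSinv_const]
  simp

/-- [folklore] **`PcT = P̂_ℂ − Π_const`** — X1-SPEC §0's audit item `R` in kernel form: an5's massless gauge projector and the periodised massive projector
differ EXACTLY by the orthogonal projector onto the constants, `Π_const v := (|T_η|⁻¹ Σ_x v x)·1`. -/
theorem PcT_eq_PhatC_sub_const (ha : 0 < a) (v : Tor (fine (m + 1) (cubic 4 p)) → ℂ) :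
    PcT (m + 1) (cubic 4 p) ((m + 1 : ℕ) : ℂ) *ᵥ v
      = PhatC m a p *ᵥ v - fun _ => (∑ x, v x) / (Fintype.card (Tor (fine (m + 1) (cubic 4 p))) : ℂ) := by
  set avg : ℂ := (∑ x, v x) / (Fintype.card (Tor (fine (m + 1) (cubic 4 p))) : ℂ) with havg
  have hcard : (Fintype.card (Tor (fine (m + 1) (cubic 4 p))) : ℂ) ≠ 0 := by exact_mod_cast Fintype.card_ne_zero
  have hdec : v = (fun z => v z - avg) + fun _ => avg := by funext z; simp
  have h0 : ∑ x, (fun z => v z - avg) x = 0 := by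
    simp only [Finset.sum_sub_distrib, Finset.sum_const, Finset.card_univ, nsmul_eq_mul, havg]
    field_simp
    ring
  conv_lhs => rw [hdec]
  rw [Matrix.mulVec_add, PcT_mulVec_const, add_zero, PcT_mulVec_eq_PhatC m p ha h0,
    show (fun z => v z - avg) = v - fun _ => avg from rfl, Matrix.mulVec_sub, PhatC_mulVec_const m p ha]

end Const

end Summit.QuantumFields.BalabanUV.Beta.D1BFx.GaugeSandwichLift

end
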